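import Summits.ResolutionOfSingularities.ResolutionOfSingularities.Theorems.FrobeniusClosingSteerWords17ALandedLeaves

/-!
# Crux `Steer` (stmt-ResolutionOfSingularities-16345), line `switching-dichotomy` — WORDS 18: §σ2.25 v2 (1) THE GRADED VOCABULARY and (2) THE FOUR PIECES of the height-graded wander split (res-D-pv-003 v2.1: `IsPosStepTwo`, `HeightTwoStepsInfinite`, `IsHitStepTwo`, `IsFinitelyHitTwo`, `NoEternalStrippedRadicandChain`, `StrippingTailHighConclTwoN`, hB₂ `BirthWanderHighConclTwoN`, hC₂ `BranchWanderHighConclTwoN`, `StrippedThreadTwoN`) (HOIST of the registered skeleton r48 380a05c149e3c83c, l.711–823, inside `section HeightSplitTwo` with its `variable {K : Type} [Field K]`)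

Holder res-L0-w41-lead-1 g6 on res-L0-w41-plan-1 RULING 47 (E1) / 104b; see `…Words01Core` for the hoist protocol (bodies byte for byte;
`[cite: …]` / `[folklore]` tags on CLOSED `def … : Prop` words are written «(ref. …)» / «(folklore)» — GATE NOTE of `…Words02Stubs`;
cite keys inside `[cite:]` tags normalised to `references.bib` keys where needed, as in `…Words03Phases`).
Nothing here is a statement of the manuscript [claim: Hironaka2017, status: under-review]. OURS (candidates / vocabulary; AI review is
weaker than expert review).
-/

open Summit.ResolutionOfSingularities.ResolutionOfSingularities.Theses.FrobeniusClosing (IsolatedForcedTermination)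
open Literature.AlgebraicGeometry.Resolution (IsAbhyankarPlace FGOver exists_ringKrullDim_eq_and_trdeg_eq
  trdeg_eq_trdeg_of_isFractionRing locAtCentre IsQuadraticTransformAlong SubringDominates IsRsopPart
  LocalUniformization3 RelLocalUniformization CossartPiltant2019General)
open Summit.ResolutionOfSingularities.ResolutionOfSingularities.Theorems.SteerRankThinness
  (HasProperCoarsening concl_of_hasProperCoarsening rankOne_of_not_hasProperCoarsening)
open Summit.ResolutionOfSingularities.ResolutionOfSingularities.Theorems.PfaffLine

set_option linter.dupNamespace false

namespace Summit.ResolutionOfSingularities.ResolutionOfSingularities.Theorems.SwitchingDichotomy.Words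

section SteeredTwo

open IsLocalRing
open Literature.AlgebraicGeometry.Resolution (IsLocalBlowupAlong IsQuadraticTransform IsExcellentRing)

variable {K : Type} [Field K]


/-! #### §σ2.25 v2 (1) — the graded vocabulary -/

/-- OURS (plan-1 RULING 25): a positive-dimensional step of HEIGHT `≥ 2` (a curve or surface centre of the 4-dimensional member, not a
divisor = stripping). -/
def IsPosStepTwo (R : ℕ → Subring K) (P : (i : ℕ) → Ideal (R i)) (j : ℕ) : Prop :=
  IsPosStep R P j ∧ 2 ≤ (P j).height

/-- OURS (plan-1 RULING 23b/25): infinitely many positive steps of height `≥ 2`. -/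
def HeightTwoStepsInfinite (R : ℕ → Subring K) (P : (i : ℕ) → Ideal (R i)) : Prop :=
  {j | IsPosStepTwo R P j}.Infinite

/-- OURS (plan-1 RULING 25): a HIT of the thread member `j` at stage `m` by a centre of height `≥ 2` (not a stripping). -/
def IsHitStepTwo (R : ℕ → Subring K) (P : (i : ℕ) → Ideal (R i)) (m j : ℕ) : Prop :=
  IsHitStep R P m j ∧ 2 ≤ (P m).height

/-- OURS (plan-1 RULING 25): the thread `J` is hit only finitely often BY CENTRES OF HEIGHT `≥ 2` (strippings may hit it for ever). -/
def IsFinitelyHitTwo (R : ℕ → Subring K) (P : (i : ℕ) → Ideal (R i)) (J : Set ℕ) : Prop :=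
  ∃ m₀ : ℕ, ∀ m, m₀ ≤ m → m ∉ J → ∀ j ∈ J, ¬ IsHitStepTwo R P m j

/-- **K♭(c) · No eternal isolated STRIPPED radicand chain in codimension `c`** (plan-1 RULING 25 + 25′ + 27a; = K(c)
`NoEternalIsolatedRadicandChain` VERBATIM except the radicand law, which allows a FREE stripping exponent `e m ≥ 1` per step:
`f (m+1) · x m ^ (p · e m) = f m − g m ^ p`, GENUINELY stripped infinitely often (`hinf : ∀ m₀, ∃ m ≥ m₀, 2 ≤ e m`, RULING 30a — a chain with
`e m = 1` eventually is K(c)'s, reached through T-i, never through F-A3); the isolatedness clause is KEPT — without it the statement is false already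
at `c = 2`, `S = k[x,y]_(x,y)`, `f = y³`, period-2 eternal stripped chain, RULING 25′): no infinite sequence of quadratic transforms of excellent
regular local rings of dimension `c` inside a field of characteristic `p` carrying radicands of multiplicity `p` (members = the POST-STRIP radicands;
cf. p511062 `cleaned_not_mem_pow_succ`), related by cleaning-and-stripping with arbitrary exponents `≥ 2` infinitely often, with isolated torsor
singularity at every stage. Book (RULING 30): `c = 2` ⟸ Lipman 1978 as printed via the NORMALISATION reading
(`Lipman1978NoEternalNormalisedBranch`, res-type-038 file 1 + res-D-pv-014 file 2); `c = 3` FRONTIER (no canonicity of Cossart–Piltant's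
sequence through the pre-stripping stages, res-type-026's flag). OURS. [cite: Lipman1978, Thm. p. 151] [cite: CossartPiltant2019, Thm. 1.5 (i)] [folklore] -/
def NoEternalStrippedRadicandChain (p c : ℕ) : Prop :=
  ∀ (L : Type) [Field L] [CharP L p] (S : ℕ → Subring L) [∀ m, IsLocalRing (S m)]
    (hle : ∀ m, S m ≤ S (m + 1)) (f g : ∀ m, S m) (x : ∀ m, S (m + 1)) (e : ℕ → ℕ) (_he : ∀ m, 1 ≤ e m)
    (_hinf : ∀ m₀, ∃ m, m₀ ≤ m ∧ 2 ≤ e m),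
    (∀ m, IsRegularLocalRing (S m)) → (∀ m, IsExcellentRing (S m)) → (∀ m, ringKrullDim (S m) = c) →
    (∀ m, IsQuadraticTransform (S m) (S (m + 1))) →
    (∀ m, Ideal.span ((fun y : S m => (⟨(y : L), hle m y.2⟩ : S (m + 1))) '' (maximalIdeal (S m) : Set (S m)))
        = Ideal.span {x m}) →
    (∀ m, ((f (m + 1) : S (m + 1)) : L) * ((x m : S (m + 1)) : L) ^ (p * e m) =
        ((f m : S m) : L) - ((g m : S m) : L) ^ p) →
    (∀ m, ∃ h : S m, f m - h ^ p ∈ maximalIdeal (S m) ^ p) →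
    (∀ m, HasIsolatedSingularity (RadicandRing (S m) p (f m))) →
    False

/-! #### §σ2.25 v2 (2) — the four pieces (common binder block of `BirthWanderConclTwoN` through `(∃ i₀, ∀ i ≥ i₀, IsHighOrderAt R s p i) →`) -/

/-- **F-B · StrippingTailHighConclTwoN** (FRONTIER — the dimension-4 double-point game): from a normalised start at `p = 2`, `n = 4`, rank one,
with no dominant tail and eventually HIGH, if only FINITELY many positive steps have height `≥ 2` but infinitely many positive steps occur
(so eventually every positive step is a stripping of a fresh exceptional divisor: point blow-ups along `O` + strippings, cleaned order `≥ 4`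
recurrent), then `Concl`. Why it might fail: no well-founded invariant for the cleaned quadratic sequence in dimension 4 at `p = 2` is on record
(`Literature.Barriers.ResolutionOfSingularities.DimensionFourFrontier`, `KangarooShadeIncrease`). OURS. (ref. CossartJannsenSaito2009, Thm. 5.25)
(ref. CutkoskyMourtada2019, Thm. 7.1) -/
def StrippingTailHighConclTwoN : Prop :=
  ∀ p : ℕ, p = 2 →
    ∀ (k K : Type) [Field k] [CharP k p] [PerfectField k] [Field K] [Algebra k K]
    (O : ValuationSubring K) (A₀ : Subalgebra k K) (h₀ : A₀.toSubring ≤ O.toSubring) (t : K),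
    CoreDatum p 4 k K O A₀ h₀ t → ¬ HasProperCoarsening O →
    ∀ (R : ℕ → Subring K) (P : (i : ℕ) → Ideal (R i)) (s : ℕ → K),
      R 0 = locAtCentre A₀.toSubring O → NormalAt O (R 0) p t → IsSteeredRun O R P t p s →
      (¬ ∃ i₀ c : ℕ, 1 ≤ c ∧ IsDominantTail R P i₀ c) →
      (∃ i₀ : ℕ, ∀ i, i₀ ≤ i → IsHighOrderAt R s p i) →
      ¬ HeightTwoStepsInfinite R P → {j | IsPosStep R P j}.Infinite → Concl O A₀ t

/-- **F-A1 · BirthWanderHighConclTwoN** (FRONTIER — births of height `≥ 2`): normalised start, no dominant tail, eventually HIGH, infinitely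
many BIRTHS (roots of the centre forest) OF HEIGHT `≥ 2` ⇒ `Concl`. Reading: births inside fresh exceptional divisors over points (regular
components of the cubic cone) or over lower centres; idea-3's (b1) regime `ν = 3`, ρ̄-class. Why it might fail: no birth invariant for
positive-dimensional centres in characteristic `p` is on record (`Literature.Barriers.ResolutionOfSingularities.DimensionFourFrontier`). OURS.
(ref. CossartJannsenSaito2009, Thm. 5.25) (ref. HeinzerEtAl2015, Discussion 4.2) -/
def BirthWanderHighConclTwoN : Prop :=
  ∀ p : ℕ, p = 2 →
    ∀ (k K : Type) [Field k] [CharP k p] [PerfectField k] [Field K] [Algebra k K]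
    (O : ValuationSubring K) (A₀ : Subalgebra k K) (h₀ : A₀.toSubring ≤ O.toSubring) (t : K),
    CoreDatum p 4 k K O A₀ h₀ t → ¬ HasProperCoarsening O →
    ∀ (R : ℕ → Subring K) (P : (i : ℕ) → Ideal (R i)) (s : ℕ → K),
      R 0 = locAtCentre A₀.toSubring O → NormalAt O (R 0) p t → IsSteeredRun O R P t p s →
      (¬ ∃ i₀ c : ℕ, 1 ≤ c ∧ IsDominantTail R P i₀ c) →
      (∃ i₀ : ℕ, ∀ i, i₀ ≤ i → IsHighOrderAt R s p i) →
      {j | IsRootStep R P j ∧ 2 ≤ (P j).height}.Infinite → Concl O A₀ t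

/-- **F-A2 · BranchWanderHighConclTwoN** (FRONTIER — branching at height `≥ 2`): normalised start, no dominant tail, eventually HIGH, some centre
OF HEIGHT `≥ 2` with infinitely many CHILDREN ⇒ `Concl`. Reading: infinitely many births of the σ_top-run of the `c`-dimensional germ at that
centre's generic point, `c ∈ {2, 3}` — the birth budget one dimension down. Why it might fail: as for F-A1; the germ's run is steered by the
GLOBAL tie-breaks. OURS. (ref. CossartPiltant2019, Thm. 1.4 (i)) (ref. HeinzerEtAl2015, Discussion 4.2) -/
def BranchWanderHighConclTwoN : Prop :=
  ∀ p : ℕ, p = 2 →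
    ∀ (k K : Type) [Field k] [CharP k p] [PerfectField k] [Field K] [Algebra k K]
    (O : ValuationSubring K) (A₀ : Subalgebra k K) (h₀ : A₀.toSubring ≤ O.toSubring) (t : K),
    CoreDatum p 4 k K O A₀ h₀ t → ¬ HasProperCoarsening O →
    ∀ (R : ℕ → Subring K) (P : (i : ℕ) → Ideal (R i)) (s : ℕ → K),
      R 0 = locAtCentre A₀.toSubring O → NormalAt O (R 0) p t → IsSteeredRun O R P t p s →
      (¬ ∃ i₀ c : ℕ, 1 ≤ c ∧ IsDominantTail R P i₀ c) →
      (∃ i₀ : ℕ, ∀ i, i₀ ≤ i → IsHighOrderAt R s p i) →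
      (∃ i, 2 ≤ (P i).height ∧ {j | IsChildStep R P i j}.Infinite) → Concl O A₀ t

/-- **F-A3 · StrippedThreadTwoN** (plan-1 RULING 25 — a words-level FUNNEL into the two K♭ debts, not new frontier): along a normalised
2-steered run with no dominant tail and eventually HIGH, an infinite THREAD `J` of height `≥ 2` that is hit only finitely often by centres of
height `≥ 2` (`IsFinitelyHitTwo`) but infinitely often altogether (`¬ IsFinitelyHit`: for ever by STRIPPINGS — by Θ2 (b) the late hits are
positive steps of height `< 2`, i.e. the cleanings of the thread's own fresh exceptional divisors) yields an ETERNAL ISOLATED STRIPPED RADICAND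
CHAIN in dimension `c ∈ {2, 3}` (= the thread's height): members = the germs at the visits, law `f' · x ^ (p·e) = f − g ^ p` with `e − 1` =
the number of strippings between two visits, isolated at every visit (a σ_top centre is a top singular COMPONENT, `IsTopSingComponent`).
Why it might fail: the isolatedness / `f − g ^ p ∈ P ^ p` bookkeeping across the strippings (pv-011's Θ1 `locChar_eq_of_le` shape with a flexible
exponent). OURS. (folklore) -/
def StrippedThreadTwoN : Prop :=
  ∀ p : ℕ, p = 2 →
    ∀ (k K : Type) [Field k] [CharP k p] [PerfectField k] [Field K] [Algebra k K]
    (O : ValuationSubring K) (A₀ : Subalgebra k K) (h₀ : A₀.toSubring ≤ O.toSubring) (t : K),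
    CoreDatum p 4 k K O A₀ h₀ t → ¬ HasProperCoarsening O →
    ∀ (R : ℕ → Subring K) (P : (i : ℕ) → Ideal (R i)) (s : ℕ → K),
      R 0 = locAtCentre A₀.toSubring O → NormalAt O (R 0) p t → IsSteeredRun O R P t p s →
      (¬ ∃ i₀ c : ℕ, 1 ≤ c ∧ IsDominantTail R P i₀ c) →
      (∃ i₀ : ℕ, ∀ i, i₀ ≤ i → IsHighOrderAt R s p i) →
      ∀ J : Set ℕ, J.Infinite → (∀ i ∈ J, ∀ j ∈ J, i < j → IsAncestorStep R P i j) →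
        (∀ j ∈ J, 2 ≤ (P j).height) → IsFinitelyHitTwo R P J → ¬ IsFinitelyHit R P J →
        ∃ c : ℕ, 2 ≤ c ∧ c ≤ 3 ∧ ¬ NoEternalStrippedRadicandChain p c

end SteeredTwo

end Summit.ResolutionOfSingularities.ResolutionOfSingularities.Theorems.SwitchingDichotomy.Words
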